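import Summits.CriticalPhenomena.PercolationContinuityZ3.Theorems.Transplant.SkelKits
import Summits.CriticalPhenomena.PercolationContinuityZ3.Theorems.Transplant.SkelSlabCube
import HarnessLib

/-!
# L5.9′ of the general node: the kit clause of a window level with the CUBE FACES of p3-g4's `SkelSlabCube` — every ROOM hypothesis of
# `SkelI.kitClause` discharged (`nearFaceOK_cube`, `cubeU_geom`, `cube_subset_shellWin`, `cubeU_subset_innerBoundary_win`); what remains are
# the Step-I inputs, arithmetic on the constants, the subbox weighting and the per-contact dichotomy `hcon`

builds on p205010 (kernel theorem, internal audit signed; external expert review pending) — nothing in this file uses p205010.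
Lane `prim-bschramm`, seat `prim-bschramm-p1` (gen 7; claim L5.9); helper file (`--supports stmt-CriticalPhenomena-4575 --as helper`);
namespace `Transplant.SkelI`, `[DecidableEq V]` binder.
**`kitClause_cube`** — constants: `M + 1 ≤ ℓs`, box sides `≥ 2T₀` (`T₀ = tanOff ℓs M = 2ℓs + 2 + M`), `R′ ≥ cylRadMax ℓs (ℓs + 2 + 2T₀)` and
`≥ cylRadMax ℓs (ℓs + 2 + M + ψ M)`, `r₀ ≥ ℓs + 1 + T₀ + R′` and `≥ 2ℓs + 2 + T₀ + M + ψ M`, `r₀ ≤ R`, `rs ≥ ℓs + 2 + T₀ + R′` and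
`≥ 2ℓs + 3 + T₀ + M + ψ M`; seed bound `sB = 1 + Δ·cS + cS·cU` with `cS = (Δ+1)^{R′} + (T₀ + 2)`, `cU = (Δ+1)^{ψ M}`; `N ≥ k (Δ+1)^{2 rs}`.
[cite: KozmaNitzan2024, §4 Lemma 10, Steps III–V (pp. 19–22)] [cite: GrimmettPercolation1999, §7.2]
-/

noncomputable section

open MeasureTheory
open scoped Classical

namespace Summit.CriticalPhenomena.PercolationContinuityZ3.Theorems

namespace Transplant

namespace SkelI

open Literature.Probability.Percolation Literature.Probability.LatticeModels SimpleGraph KNLevels KozmaNitzan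
open Literature.Probability.Percolation.GM (HOct)
open Literature.Barriers.CriticalPhenomena (graphBall)
open Skel (winGraph winLevel winLData inNbr fatSeq macroPiece fatRadius cubeCtr cylBall_mono)

variable {V : Type} [DecidableEq V] {G : SimpleGraph V} [G.LocallyFinite] (Φ : PlanarSkeletonConc G)

/-- **The kit clause of a window level with Lemma-9 cube faces** (all room hypotheses of `kitClause` discharged by `SkelSlabCube`).
[cite: KozmaNitzan2024, §4 Lemma 10, Steps III–IV (pp. 19–21)] -/
theorem kitClause_cube [Countable V] {p : unitInterval} (hC : Φ.toPlanarSkeleton.CylSubcritical p) (msel : V → ℕ) {Ssc : Finset ℕ}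
    {q : unitInterval} {δ : ℝ} (hδ : 0 < δ)
    (hin : ∀ i ∈ Skel.inputIndex Φ Ssc, 1 - δ ^ 2 < (bondPercolation G q).real (Skel.inputEvent Φ hC msel i))
    {M : ℕ} (hM : M ∈ Ssc) (hmsel : ∀ t ∈ Φ.types, msel t ≤ M)
    {w₀ : V} {R : ℕ} {lo hi : Site 2} {j ℓs R' r₀ rs : ℕ} (hMℓ : M + 1 ≤ ℓs)
    (hwide : ∀ i, (lo - (j : Site 2)) i + 2 * tanOff ℓs M ≤ (hi + (j : Site 2)) i)
    (hR'₁ : Φ.cylRadMax ℓs (ℓs + 2 + 2 * tanOff ℓs M) ≤ R') (hR'₂ : Φ.cylRadMax ℓs (ℓs + 2 + M + fatRadius Φ hC M) ≤ R')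
    (hr₀₁ : ℓs + 1 + tanOff ℓs M + R' ≤ r₀) (hr₀₂ : 2 * ℓs + 2 + tanOff ℓs M + M + fatRadius Φ hC M ≤ r₀) (hR : r₀ ≤ R)
    (hrs₁ : ℓs + 2 + tanOff ℓs M + R' ≤ rs) (hrs₂ : 2 * ℓs + 3 + tanOff ℓs M + M + fatRadius Φ hC M ≤ rs)
    (k : ℕ) (o : V) (Sfin : Finset V) {Wt : Sym2 V → unitInterval} {D T : Finset V}
    (hWD : IsSubbox (winGraph G w₀ R) Wt q D) (hXD : winLevel Φ w₀ R lo hi j ⊆ D) {N : ℕ}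
    (hN : k * (Φ.Δ + 1) ^ (2 * rs) ≤ N)
    (hk : (1 - (q : ℝ) ^ (1 + Φ.Δ * ((Φ.Δ + 1) ^ R' + (tanOff ℓs M + 2)) +
      ((Φ.Δ + 1) ^ R' + (tanOff ℓs M + 2)) * (Φ.Δ + 1) ^ fatRadius Φ hC M)) ^ k ≤ δ)
    (hcon : ∀ x ∈ outerBoundary (winGraph G w₀ R) (winLevel Φ w₀ R lo hi j),
      (∃ u ∈ (slabGeomDeep Φ w₀ R lo hi j ℓs M R' r₀ (cubeU Φ hC w₀ R lo hi j ℓs M)).U x, u ∈ T) ∨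
      (inNbr Φ w₀ R (Finset.Icc (lo - (j : Site 2)) (hi + (j : Site 2))) x ∈ graphBall G w₀ (R - r₀) ∧ ∀ t ∈ Φ.types,
        (∀ M' ∈ Ssc, 1 - δ ^ 2 < (bondPercolation G q).real (UniqZone.zone G (fatSeq Φ hC (cubeCtr Φ (deepCtr Φ w₀ R (lo - (j : Site 2)) (hi + (j : Site 2)) ℓs M x) (exitDir Φ w₀ R (lo - (j : Site 2)) (hi + (j : Site 2)) x).1 (exitDir Φ w₀ R (lo - (j : Site 2)) (hi + (j : Site 2)) x).2 ℓs M)) (msel t) M') ∧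
          ∀ g' : HOct 2, 1 - δ ^ 2 < (bondPercolation G q).real
            (linkIn (↑(fatSeq Φ hC (cubeCtr Φ (deepCtr Φ w₀ R (lo - (j : Site 2)) (hi + (j : Site 2)) ℓs M x) (exitDir Φ w₀ R (lo - (j : Site 2)) (hi + (j : Site 2)) x).1 (exitDir Φ w₀ R (lo - (j : Site 2)) (hi + (j : Site 2)) x).2 ℓs M) M')) (fatSeq Φ hC (cubeCtr Φ (deepCtr Φ w₀ R (lo - (j : Site 2)) (hi + (j : Site 2)) ℓs M x) (exitDir Φ w₀ R (lo - (j : Site 2)) (hi + (j : Site 2)) x).1 (exitDir Φ w₀ R (lo - (j : Site 2)) (hi + (j : Site 2)) x).2 ℓs M) (msel t)) (macroPiece Φ (cubeCtr Φ (deepCtr Φ w₀ R (lo - (j : Site 2)) (hi + (j : Site 2)) ℓs M x) (exitDir Φ w₀ R (lo - (j : Site 2)) (hi + (j : Site 2)) x).1 (exitDir Φ w₀ R (lo - (j : Site 2)) (hi + (j : Site 2)) x).2 ℓs M) M' (fatRadius Φ hC M') g'))) →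
        ∃ Qt Ft : Finset V, Ft ⊆ T ∧ Qt ⊆ D ∧ (∀ u ∈ Qt, ∀ v ∈ Qt, G.Adj u v → (winGraph G w₀ R).Adj u v) ∧
          Disjoint Ft (fatSeq Φ hC (cubeCtr Φ (deepCtr Φ w₀ R (lo - (j : Site 2)) (hi + (j : Site 2)) ℓs M x) (exitDir Φ w₀ R (lo - (j : Site 2)) (hi + (j : Site 2)) x).1 (exitDir Φ w₀ R (lo - (j : Site 2)) (hi + (j : Site 2)) x).2 ℓs M) M) ∧
          1 - δ ^ 2 < (prodBernoulli Wt).real (linkIn (↑Qt) (fatSeq Φ hC (cubeCtr Φ (deepCtr Φ w₀ R (lo - (j : Site 2)) (hi + (j : Site 2)) ℓs M x) (exitDir Φ w₀ R (lo - (j : Site 2)) (hi + (j : Site 2)) x).1 (exitDir Φ w₀ R (lo - (j : Site 2)) (hi + (j : Site 2)) x).2 ℓs M) (msel t)) Ft))) :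
    ∃ (σ : SData V) (S : Finset V), SHyp (winLData Φ w₀ R lo hi o Sfin) j σ ∧ σ.N ≤ N ∧
      (1 - (q : ℝ) ^ σ.sB) ^ σ.k ≤ δ ∧ S ⊆ (winLData Φ w₀ R lo hi o Sfin).X j ∧ S ⊆ D ∧
      (∀ x ∈ σ.K, ∀ e ∈ σ.seed x, e ∉ wireSet (↑S : Set V)) ∧ (∀ x ∈ σ.K, σ.face x ⊆ S) ∧
      (∀ x ∈ σ.K, 1 - 3 * δ ≤ (prodBernoulli Wt).real {ω | ∃ u ∈ σ.face x,
        1 - δ < (prodBernoulli (pinW Wt (wireSet (↑S : Set V)) ω)).real (⋃ t ∈ T, openConnIn (↑D : Set V) u t)}) := by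
  have hℓs : 1 ≤ ℓs := by omega
  have hR' : ∀ c : V, graphBall G c (ℓs + 2 + 2 * tanOff ℓs M) ∩ Φ.toPlanarSkeleton.cyl c ℓs ⊆ Φ.cylBall c ℓs R' :=
    fun c v hv => cylBall_mono Φ c le_rfl hR'₁ (Φ.prism_subset_cylBall c hℓs (ℓs + 2 + 2 * tanOff ℓs M) ⟨hv.1, hv.2⟩)
  exact kitClause Φ hC msel hδ hin hM hmsel hℓs hwide hR' hr₀₁ hR hrs₁ (nearFaceOK_cube Φ hC hMℓ hwide hR'₂ hr₀₂ hR hrs₂ le_rfl)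
    (fun x _ _ => rfl) (fun x hx u hu => (cubeU_geom Φ hC hwide hx hu).2.2)
    (fun x hx hnear => ⟨cube_subset_shellWin Φ hC hwide hr₀₂ hR hx hnear,
      cubeU_subset_innerBoundary_win Φ hC hMℓ hwide hR'₂ hr₀₁ hr₀₂ hR hx hnear⟩) k o Sfin hWD hXD hN hk hcon

end SkelI

end Transplant

end Summit.CriticalPhenomena.PercolationContinuityZ3.Theorems

end
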